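import Summits.HubbardSuperconductivity.HubbardSuperconductivity.Theorems.WeakCouplingBCSKlLindhardEnclosureFloorStructural

/-!
# KL-MARGIN-SCAN reader (22) «kernel-lindhard-enclosure» — STRUCTURAL SOUNDNESS OF THE CEILING: `CeilSoundAt P t` from per-leaf soundness

Twin of `…KlLindhardEnclosureFloorStructural` for the ceiling predicate of the round-11 instrument (Gate §4): the fused kernel evaluation
`QB.eval` returns a ceiling `some N` only if EVERY leaf of the tree returned a certified ceiling (`addO` is `none`-absorbing, a cut outside the
cell voids the ceiling), and the sub-cells of every internal node COVER the node's half-open cell exactly; so if each LEAF ceiling certifies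
integrability of the two-shell integrand on its own cell together with `2^30 ∫_cell F ≤ N_leaf` (`LeafCeilSoundAt P` — the per-rule analytic
debt: zero ceiling on certified same-side cells, chord / crude / majorised-hyperbola / tip rules), then for EVERY certificate tree the root
evaluation certifies integrability on the root square `⊇ [−π, π)²` and `2^30 ∫_BZ F ≤ N` — i.e. `CeilSoundAt P t`.  Honest framing: a
reduction, not a discharge — `LeafCeilSoundAt` is NOT proved here; floats are floats; nothing in this file asserts a KL margin at any
`t′ ≠ 0`, `K₃`, `U₀`, the window or B1g dominance; a Kohn–Luttinger instability statement is not ODLRO and nothing here proves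
superconductivity in the Hubbard model.  (p1 g25, 2026-08-29.)
-/

noncomputable section

set_option linter.dupNamespace false

namespace Summit.HubbardSuperconductivity.HubbardSuperconductivity.Theorems.KlLindhardEnclosure

open Real Set MeasureTheory Literature.MathematicalPhysics.QuantumLattice
open Summit.HubbardSuperconductivity.HubbardSuperconductivity.Theorems

/-! ## §1 Cells: the whole-cell integral, exact covering by the two halves -/

/-- The integral of the two-shell integrand over the whole grid cell `[a/U, b/U) × [c/U, d/U)`. -/
def Params.cellInt (P : Params) (a b c d : ℤ) : ℝ :=
  ∫ p in P.cellSet a b c d, P.integrand p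

/-- `addO` returns `some` only from two `some`s, and then adds. -/
theorem addO_eq_some {x y : Option ℤ} {N : ℤ} (h : addO x y = some N) :
    ∃ N₁ N₂ : ℤ, x = some N₁ ∧ y = some N₂ ∧ N = N₁ + N₂ := by
  cases x with
  | none => simp [addO] at h
  | some u =>
    cases y with
    | none => simp [addO] at h
    | some v =>
      simp only [addO, Option.some.injEq] at h
      exact ⟨u, v, rfl, rfl, h.symm⟩

/-- The two halves of a cell split at an abscissa are disjoint. -/
theorem Params.cellSet_disjoint_x (P : Params) (a m b c d : ℤ) : Disjoint (P.cellSet a m c d) (P.cellSet m b c d) := by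
  rw [Set.disjoint_left]
  intro p hpA hpB
  simp only [Params.cellSet, mem_setOf_eq] at hpA hpB
  linarith [hpA.2.1, hpB.1]

/-- The two halves of a cell split at an ordinate are disjoint. -/
theorem Params.cellSet_disjoint_y (P : Params) (a b c m d : ℤ) : Disjoint (P.cellSet a b c m) (P.cellSet a b m d) := by
  rw [Set.disjoint_left]
  intro p hpA hpB
  simp only [Params.cellSet, mem_setOf_eq] at hpA hpB
  linarith [hpA.2.2.2, hpB.2.2.1]

/-- Splitting a cell at an abscissa `m` BETWEEN its ends (in either order) covers it exactly. -/
theorem Params.cellSet_split_x (P : Params) (hU : 0 < P.U) {a m b : ℤ} (hm : (a ≤ m ∧ m ≤ b) ∨ (b ≤ m ∧ m ≤ a))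
    (c d : ℤ) : P.cellSet a b c d = P.cellSet a m c d ∪ P.cellSet m b c d := by
  ext p
  simp only [Params.cellSet, mem_setOf_eq, mem_union]
  rcases hm with ⟨h1, h2⟩ | ⟨h1, h2⟩
  · have e1 := P.cast_toQ_mono hU h1
    have e2 := P.cast_toQ_mono hU h2
    constructor
    · rintro ⟨h01, h02, h03, h04⟩
      by_cases hp : p 0 < ((P.toQ m : ℚ) : ℝ)
      · exact Or.inl ⟨h01, hp, h03, h04⟩
      · exact Or.inr ⟨le_of_not_gt hp, h02, h03, h04⟩
    · rintro (⟨h01, h02, h03, h04⟩ | ⟨h01, h02, h03, h04⟩)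
      · exact ⟨h01, lt_of_lt_of_le h02 e2, h03, h04⟩
      · exact ⟨le_trans e1 h01, h02, h03, h04⟩
  · have e1 := P.cast_toQ_mono hU h1
    have e2 := P.cast_toQ_mono hU h2
    constructor
    · rintro ⟨h01, h02, h03, h04⟩
      exact absurd (lt_of_le_of_lt h01 h02) (not_lt.mpr (e1.trans e2))
    · rintro (⟨h01, h02, h03, h04⟩ | ⟨h01, h02, h03, h04⟩)
      · exact absurd (lt_of_lt_of_le (lt_of_le_of_lt h01 h02) e2) (lt_irrefl _)
      · exact absurd (lt_of_lt_of_le (lt_of_le_of_lt h01 h02) e1) (lt_irrefl _)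

/-- Splitting a cell at an ordinate `m` BETWEEN its ends (in either order) covers it exactly. -/
theorem Params.cellSet_split_y (P : Params) (hU : 0 < P.U) (a b : ℤ) {c m d : ℤ}
    (hm : (c ≤ m ∧ m ≤ d) ∨ (d ≤ m ∧ m ≤ c)) : P.cellSet a b c d = P.cellSet a b c m ∪ P.cellSet a b m d := by
  ext p
  simp only [Params.cellSet, mem_setOf_eq, mem_union]
  rcases hm with ⟨h1, h2⟩ | ⟨h1, h2⟩
  · have e1 := P.cast_toQ_mono hU h1
    have e2 := P.cast_toQ_mono hU h2
    constructor
    · rintro ⟨h01, h02, h03, h04⟩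
      by_cases hp : p 1 < ((P.toQ m : ℚ) : ℝ)
      · exact Or.inl ⟨h01, h02, h03, hp⟩
      · exact Or.inr ⟨h01, h02, le_of_not_gt hp, h04⟩
    · rintro (⟨h01, h02, h03, h04⟩ | ⟨h01, h02, h03, h04⟩)
      · exact ⟨h01, h02, h03, lt_of_lt_of_le h04 e2⟩
      · exact ⟨h01, h02, le_trans e1 h03, h04⟩
  · have e1 := P.cast_toQ_mono hU h1
    have e2 := P.cast_toQ_mono hU h2
    constructor
    · rintro ⟨h01, h02, h03, h04⟩
      exact absurd (lt_of_le_of_lt h03 h04) (not_lt.mpr (e1.trans e2))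
    · rintro (⟨h01, h02, h03, h04⟩ | ⟨h01, h02, h03, h04⟩)
      · exact absurd (lt_of_lt_of_le (lt_of_le_of_lt h03 h04) e2) (lt_irrefl _)
      · exact absurd (lt_of_lt_of_le (lt_of_le_of_lt h03 h04) e1) (lt_irrefl _)

/-- Integrability and the integral of a cell from its two halves (split at an abscissa between the ends). -/
theorem Params.cellInt_merge_x (P : Params) (hU : 0 < P.U) {a m b : ℤ} (hm : (a ≤ m ∧ m ≤ b) ∨ (b ≤ m ∧ m ≤ a)) (c d : ℤ)
    (hA : IntegrableOn P.integrand (P.cellSet a m c d) volume) (hB : IntegrableOn P.integrand (P.cellSet m b c d) volume) :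
    IntegrableOn P.integrand (P.cellSet a b c d) volume ∧ P.cellInt a b c d = P.cellInt a m c d + P.cellInt m b c d := by
  rw [Params.cellInt, P.cellSet_split_x hU hm c d]
  exact ⟨hA.union hB, setIntegral_union (P.cellSet_disjoint_x a m b c d) (P.measurableSet_cellSet m b c d) hA hB⟩

/-- Integrability and the integral of a cell from its two halves (split at an ordinate between the ends). -/
theorem Params.cellInt_merge_y (P : Params) (hU : 0 < P.U) (a b : ℤ) {c m d : ℤ} (hm : (c ≤ m ∧ m ≤ d) ∨ (d ≤ m ∧ m ≤ c))
    (hA : IntegrableOn P.integrand (P.cellSet a b c m) volume) (hB : IntegrableOn P.integrand (P.cellSet a b m d) volume) :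
    IntegrableOn P.integrand (P.cellSet a b c d) volume ∧ P.cellInt a b c d = P.cellInt a b c m + P.cellInt a b m d := by
  rw [Params.cellInt, P.cellSet_split_y hU a b hm]
  exact ⟨hA.union hB, setIntegral_union (P.cellSet_disjoint_y a b c m d) (P.measurableSet_cellSet a b m d) hA hB⟩

/-! ## §2 Per-leaf ceiling soundness and the structural theorem -/

/-- **PER-LEAF CEILING SOUNDNESS at `P`** (the analytic debt, leaf rule by leaf rule): for every leaf cell with `mkX/mkY` corner records and
every hint payload, if the leaf CERTIFIES a ceiling numerator `N` (units `2^-30`) then the two-shell integrand is integrable on the whole cell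
and `2^30 ∫_cell F ≤ N` (same-side cells `N = 0` with `F = 0` on the cell; chord / crude / majorised hyperbola / tip rules otherwise; a leaf
that cannot certify returns `none` and is not constrained). [folklore] -/
def LeafCeilSoundAt (P : Params) : Prop :=
  ∀ (bd : Option (ℕ × ℕ × ℕ × ℕ)) (tp : Option (ℕ × ℕ × ℕ × ℕ × ℕ × ℕ × ℕ × ℕ)) (a b c d N : ℤ),
    (P.leaf bd tp (P.mkX a) (P.mkX b) (P.mkY c) (P.mkY d)).2 = some N →
      IntegrableOn P.integrand (P.cellSet a b c d) volume ∧ 2 ^ 30 * P.cellInt a b c d ≤ (N : ℝ)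

/-- **TREE INDUCTION**: under per-leaf ceiling soundness, whenever the fused evaluation of ANY certificate tree on ANY cell with `mkX/mkY` corner
records certifies a ceiling `some N`, the integrand is integrable on that cell and `2^30 ∫_cell F ≤ N`. -/
theorem eval_snd_sound (P : Params) (hU : 0 < P.U) (hleaf : LeafCeilSoundAt P) (t : QB) :
    ∀ a b c d N : ℤ, (t.eval P (P.mkX a) (P.mkX b) (P.mkY c) (P.mkY d)).2 = some N →
      IntegrableOn P.integrand (P.cellSet a b c d) volume ∧ 2 ^ 30 * P.cellInt a b c d ≤ (N : ℝ) := by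
  induction t with
  | o => intro a b c d N h; exact hleaf none none a b c d N (by simpa [QB.eval] using h)
  | d σx σy τx τy => intro a b c d N h; exact hleaf (some (σx, σy, τx, τy)) none a b c d N (by simpa [QB.eval] using h)
  | w a1 a2 a3 a4 a5 a6 a7 a8 =>
      intro a b c d N h; exact hleaf none (some (a1, a2, a3, a4, a5, a6, a7, a8)) a b c d N (by simpa [QB.eval] using h)
  | n c00 c10 c01 c11 ih00 ih10 ih01 ih11 =>
      intro a b c d N h
      simp only [QB.eval, Params.mkX_z, Params.mkY_z] at h
      obtain ⟨Nl, Nr, hl, hr, hN⟩ := addO_eq_some h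
      obtain ⟨N00, N10, h00, h10, hNl⟩ := addO_eq_some hl
      obtain ⟨N01, N11, h01, h11, hNr⟩ := addO_eq_some hr
      obtain ⟨i00, b00⟩ := ih00 a ((a + b) / 2) c ((c + d) / 2) N00 h00
      obtain ⟨i10, b10⟩ := ih10 ((a + b) / 2) b c ((c + d) / 2) N10 h10
      obtain ⟨i01, b01⟩ := ih01 a ((a + b) / 2) ((c + d) / 2) d N01 h01
      obtain ⟨i11, b11⟩ := ih11 ((a + b) / 2) b ((c + d) / 2) d N11 h11
      obtain ⟨iL, eL⟩ := P.cellInt_merge_x hU (midpoint_between a b) c ((c + d) / 2) i00 i10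
      obtain ⟨iU, eU⟩ := P.cellInt_merge_x hU (midpoint_between a b) ((c + d) / 2) d i01 i11
      obtain ⟨iT, eT⟩ := P.cellInt_merge_y hU a b (midpoint_between c d) iL iU
      refine ⟨iT, ?_⟩
      rw [eT, eL, eU, hN, hNl, hNr]
      push_cast
      linarith
  | cx z l r ihl ihr =>
      intro a b c d N h
      simp only [QB.eval, Params.mkX_z] at h
      split_ifs at h with hz
      · obtain ⟨Nl, Nr, hl, hr, hN⟩ := addO_eq_some h
        obtain ⟨il, bl⟩ := ihl a z c d Nl hl
        obtain ⟨ir, br⟩ := ihr z b c d Nr hr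
        obtain ⟨iT, eT⟩ := P.cellInt_merge_x hU (Or.inl ⟨hz.1.le, hz.2.le⟩) c d il ir
        refine ⟨iT, ?_⟩
        rw [eT, hN]; push_cast; linarith
  | cy z l r ihl ihr =>
      intro a b c d N h
      simp only [QB.eval, Params.mkY_z] at h
      split_ifs at h with hz
      · obtain ⟨Nl, Nr, hl, hr, hN⟩ := addO_eq_some h
        obtain ⟨il, bl⟩ := ihl a b c z Nl hl
        obtain ⟨ir, br⟩ := ihr a b z d Nr hr
        obtain ⟨iT, eT⟩ := P.cellInt_merge_y hU a b (Or.inl ⟨hz.1.le, hz.2.le⟩) il ir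
        refine ⟨iT, ?_⟩
        rw [eT, hN]; push_cast; linarith
  | bx l r ihl ihr =>
      intro a b c d N h
      simp only [QB.eval, Params.mkX_z] at h
      obtain ⟨Nl, Nr, hl, hr, hN⟩ := addO_eq_some h
      obtain ⟨il, bl⟩ := ihl a ((a + b) / 2) c d Nl hl
      obtain ⟨ir, br⟩ := ihr ((a + b) / 2) b c d Nr hr
      obtain ⟨iT, eT⟩ := P.cellInt_merge_x hU (midpoint_between a b) c d il ir
      refine ⟨iT, ?_⟩
      rw [eT, hN]; push_cast; linarith
  | bY l r ihl ihr =>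
      intro a b c d N h
      simp only [QB.eval, Params.mkY_z] at h
      obtain ⟨Nl, Nr, hl, hr, hN⟩ := addO_eq_some h
      obtain ⟨il, bl⟩ := ihl a b c ((c + d) / 2) Nl hl
      obtain ⟨ir, br⟩ := ihr a b ((c + d) / 2) d Nr hr
      obtain ⟨iT, eT⟩ := P.cellInt_merge_y hU a b (midpoint_between c d) il ir
      refine ⟨iT, ?_⟩
      rw [eT, hN]; push_cast; linarith

/-- For admissible `P` the zone lies inside the root square `[−Xz/U, Xz/U)²`. -/
theorem Params.brillouinZone_subset_rootCell (P : Params) (hP : P.admissible = true) :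
    brillouinZone ⊆ P.cellSet (-P.Xz) P.Xz (-P.Xz) P.Xz := by
  intro p hp
  have hπ := P.pi_le_Xz_div_U hP
  have h0 := hp 0
  have h1 := hp 1
  simp only [mem_Ico] at h0 h1
  simp only [Params.cellSet, mem_setOf_eq, P.cast_toQ, Int.cast_neg, neg_div]
  refine ⟨?_, ?_, ?_, ?_⟩ <;> linarith [h0.1, h0.2, h1.1, h1.2]

/-- **STRUCTURAL CEILING SOUNDNESS**: per-leaf ceiling soundness at `P` implies `CeilSoundAt P t` for EVERY certificate tree `t`. -/
theorem ceilSoundAt_of_leafCeilSound (P : Params) (hleaf : LeafCeilSoundAt P) (t : QB) : CeilSoundAt P t := by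
  intro N hP hN
  have hU := P.U_pos_of_admissible hP
  obtain ⟨hint, hle⟩ := eval_snd_sound P hU hleaf t (-P.Xz) P.Xz (-P.Xz) P.Xz N hN
  have hsub := P.brillouinZone_subset_rootCell hP
  refine ⟨hint.mono_set hsub, ?_⟩
  have hmono : (∫ p in brillouinZone, P.integrand p) ≤ P.cellInt (-P.Xz) P.Xz (-P.Xz) P.Xz :=
    setIntegral_mono_set hint (Filter.Eventually.of_forall fun p => P.integrand_nonneg p) (Filter.Eventually.of_forall hsub)
  linarith

/-- **BOTH PREDICATES AT ONCE**: per-leaf floor and ceiling soundness give the two named hypotheses of every gate theorem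
(`lindhard_mem_enclosure`, `hull_contains`, `hull_excluded_below/above`) for every certificate tree. -/
theorem soundAt_of_leafSound (P : Params) (hF : LeafFloorSoundAt P) (hC : LeafCeilSoundAt P) (t : QB) :
    FloorSoundAt P t ∧ CeilSoundAt P t :=
  ⟨floorSoundAt_of_leafFloorSound P hF t, ceilSoundAt_of_leafCeilSound P hC t⟩

end Summit.HubbardSuperconductivity.HubbardSuperconductivity.Theorems.KlLindhardEnclosure

end
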